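import Summits.CriticalPhenomena.PercolationContinuityZ3.Theorems.Transplant.FKConnectivityAllQPat3ShapeOneCone
import Summits.CriticalPhenomena.PercolationContinuityZ3.Theorems.Transplant.FKConnectivityAllQPat3MinorCone
import HarnessLib

/-!
# Connectivity correlation inequalities for `φ_{w,q}`, every `q > 0` — THREE MARKED PIECES ON AN EXPLICIT SKELETON: the composite
# minor's two-level value as a `tripleSumC` (census g37's vocabulary), so that g36/g37's symmetrised product-cone machinery applies
# to K₄-skeleton leaves (census g39 §3 VEE\*, EEE-triangle/claw/path; §11 (ii)–(iii), `t = 3`)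

Definitions + theorems file (`--supports stmt-CriticalPhenomena-4575`), census lineage (gen 40) of LANE 2's FK sub-programme; builds on
p205010 (kernel theorem, internal audit signed; external expert review pending).  No named facts, no sorries; standard axioms.

* `FK.side3`, **`FK.shape3X`** (DEFINITIONS, computable) — one colour side of a three-piece shape (skeleton folded from the identity
  matrix, pieces `K, 1, 2` attached by `FK.attachPat` in turn; final matrix + total correction) and the TARGET-SIDE TERM in the
  format of g36's `FK.tripleSum` / g37's `FK.tripleSumC`: at piece levels `eK e1 e2`, pattern pairs and top level `N`, the table
  `F` read at the composite patterns summed over the skeleton colourings whose corrections make the levels match.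
* **`FK.lev2C_shape3`** — `lev2C (plainSet p L ∪ EK ∪ E₁ ∪ E₂) (CK ∪ C₁ ∪ C₂) x y s F μ = tripleSumC EK CK E₁ C₁ E₂ C₂ … (shape3X …
  F (μ + |L| + 4|V|))` (three `FK.sum_attachPatCC`/`FK.sum_attachPatC` peels and `FK.sum_plainList_empty`; the `4|V|` is g36's
  `S = 4|V|` of the theta law: two-point gluings cost `2|V|` each beyond the first).  CONSEQUENCE for the successor: the t = 3 cone
  theorem is g37's `cone3C_level_nonneg_sym` with `shape3X` in place of `xterm join corr T` (same `tripleSumC_symm8`,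
  `tripleSumC_bterm_nonneg`, `Prod3.tensor` certificates) — DONE HERE: `FK.coefTab3`, `FK.symm8d` and **`FK.shape3C_nonneg_of_rows`**: rowwise domination `8·Σ λ·tensor ≤ Dn·symm8d
  (coefTab3 …)` by `Prod3` generators levelwise nonnegative on the three piece minors ⇒ `F ≥ 0` levelwise on the composite minor;
  the certificate checks producing the rows (direct `FK.certCheck3S`, and the tabulated/filtered one) are in `…Pat3ShapeThreeTab.lean`.
[cite: Grimmett2006, §1.4 eq. (1.20) (p. 15); §3.8 (pp. 61–62)] [cite: AyyerLinussonRavichandran2025, §7 (p. 22)]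
-/

namespace Summit.CriticalPhenomena.PercolationContinuityZ3.Theorems

namespace FK

open SimpleGraph Literature.Probability.LatticeModels Literature.Probability.Percolation
open scoped Classical

variable {V : Type*}

/-! ### Three marked pieces on an explicit skeleton: the composite as a `tripleSumC` (census g37's vocabulary) -/

section ShapeThree

variable [Fintype V] {ι : Type*} [DecidableEq ι]

/-- One colour side of a three-piece shape: the skeleton folded from the identity matrix, then the three pieces attached in the
order `K, 1, 2`; returns the final matrix and the total level correction of this side. [folklore] -/
def side3 (L : List (ι × ι)) (iK jK kK i1 j1 k1 i2 j2 k2 : ι) (bs : List Bool) (PK P1 P2 : Pat3) : (ι → ι → Bool) × ℕ :=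
  ((attachPat (attachPat (attachPat (foldBits (idMat ι) (zipBits L bs)).1 iK jK kK PK) i1 j1 k1 P1) i2 j2 k2 P2),
    (foldBits (idMat ι) (zipBits L bs)).2 +
      (if (foldBits (idMat ι) (zipBits L bs)).1 iK jK && PK.xy then 1 else 0) +
      (if (attachPat (foldBits (idMat ι) (zipBits L bs)).1 iK jK kK PK) i1 j1 && P1.xy then 1 else 0) +
      (if (attachPat (attachPat (foldBits (idMat ι) (zipBits L bs)).1 iK jK kK PK) i1 j1 k1 P1) i2 j2 && P2.xy then 1 else 0))

/-- **The target-side term of a three-piece shape** in census g36/g37's `tripleSum(C)` format: at piece levels `eK, e1, e2`, piece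
pattern pairs and top level `N` (= `μ + |L| + 4|V|`: three two-point gluings), the two-level table `F` read at the composite patterns, summed over the skeleton
colourings whose corrections make the levels match.  Computable. [folklore] -/
def shape3X (L : List (ι × ι)) (iK jK kK i1 j1 k1 i2 j2 k2 ix iy is : ι) (F : ℕ → Pat3 → Pat3 → ℤ) (N : ℕ) :
    ℕ → ℕ → ℕ → Pat3 → Pat3 → Pat3 → Pat3 → Pat3 → Pat3 → ℤ :=
  fun eK e1 e2 PK QK P1 Q1 P2 Q2 => sumBits L.length fun bs =>
    (if eK + e1 + e2 + ((side3 L iK jK kK i1 j1 k1 i2 j2 k2 bs PK P1 P2).2 +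
          (side3 L iK jK kK i1 j1 k1 i2 j2 k2 (bs.map (! ·)) QK Q1 Q2).2) = N then
        F 0 (rdPat ix iy is (side3 L iK jK kK i1 j1 k1 i2 j2 k2 bs PK P1 P2).1)
          (rdPat ix iy is (side3 L iK jK kK i1 j1 k1 i2 j2 k2 (bs.map (! ·)) QK Q1 Q2).1) else 0) +
      (if eK + e1 + e2 + ((side3 L iK jK kK i1 j1 k1 i2 j2 k2 bs PK P1 P2).2 +
          (side3 L iK jK kK i1 j1 k1 i2 j2 k2 (bs.map (! ·)) QK Q1 Q2).2) + 1 = N then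
        F 1 (rdPat ix iy is (side3 L iK jK kK i1 j1 k1 i2 j2 k2 bs PK P1 P2).1)
          (rdPat ix iy is (side3 L iK jK kK i1 j1 k1 i2 j2 k2 (bs.map (! ·)) QK Q1 Q2).1) else 0)


omit [Fintype V] [DecidableEq ι] in
/-- Two two-level reads agree when their level equations are shifts of each other. [folklore] -/
theorem lev_pair_congr {N₁ N₂ M₁ M₂ : ℕ} (h : N₁ + M₂ = N₂ + M₁) (X Y : ℤ) :
    ((if N₁ = M₁ then X else 0) + (if N₁ + 1 = M₁ then Y else 0)) =
      ((if N₂ = M₂ then X else 0) + (if N₂ + 1 = M₂ then Y else 0)) := by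
  rw [ite_eq_ite_of_iff (show N₁ = M₁ ↔ N₂ = M₂ by omega) rfl, ite_eq_ite_of_iff (show N₁ + 1 = M₁ ↔ N₂ + 1 = M₂ by omega) rfl]

variable {p : ι → V} {L : List (ι × ι)} {EK CK E₁ C₁ E₂ C₂ : Finset (Sym2 V)} {VK V₁ V₂ : Set V}
  {uK vK mK u₁ v₁ m₁ u₂ v₂ m₂ x y s : V} {iK jK kK i1 j1 k1 i2 j2 k2 ix iy is : ι}

/-- **THE TWO-LEVEL VALUE OF A THREE-PIECE SHAPE AS A TRIPLE SUM** (explicit skeleton `L` on injective names; three marked pieces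
`(E_b, C_b; u_b, v_b, m_b)` on `V_b`, `b = K, 1, 2`, read as minors, glued at the names `(i_b, j_b)` with mark names `k_b`; pieces
meet the rest only at their terminals; marks read at the names `ix, iy, is`): `lev2C` of the composite minor is the `tripleSumC` of
`FK.shape3X` — so census g37's `tripleSumC_symm8` / `tripleSumC_bterm_nonneg` apply to K₄-skeleton leaves (VEE\*, EEE) verbatim,
with `shape3X` in place of the `xterm` of a join/corr law. [folklore] -/
theorem lev2C_shape3 (hinj : Function.Injective p)
    (hEK : ∀ e ∈ (↑(EK ∪ CK) : Set (Sym2 V)), ∀ z ∈ e, z ∈ VK) (hE1 : ∀ e ∈ (↑(E₁ ∪ C₁) : Set (Sym2 V)), ∀ z ∈ e, z ∈ V₁)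
    (hE2 : ∀ e ∈ (↑(E₂ ∪ C₂) : Set (Sym2 V)), ∀ z ∈ e, z ∈ V₂)
    (hpK : ∀ a, p a ∈ VK → p a = uK ∨ p a = vK ∨ p a = mK) (hp1 : ∀ a, p a ∈ V₁ → p a = u₁ ∨ p a = v₁ ∨ p a = m₁)
    (hp2 : ∀ a, p a ∈ V₂ → p a = u₂ ∨ p a = v₂ ∨ p a = m₂)
    (hK1 : ∀ z ∈ VK, z ∈ V₁ → z = u₁ ∨ z = v₁) (hK2 : ∀ z ∈ VK, z ∈ V₂ → z = u₂ ∨ z = v₂) (h12 : ∀ z ∈ V₁, z ∈ V₂ → z = u₂ ∨ z = v₂)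
    (hmK : mK ∈ VK) (hm1 : m₁ ∈ V₁) (hm2 : m₂ ∈ V₂) (huvK : uK ≠ vK) (huv1 : u₁ ≠ v₁) (huv2 : u₂ ≠ v₂)
    (hiK : p iK = uK) (hjK : p jK = vK) (hkK : p kK = mK) (hi1 : p i1 = u₁) (hj1 : p j1 = v₁) (hk1 : p k1 = m₁)
    (hi2 : p i2 = u₂) (hj2 : p j2 = v₂) (hk2 : p k2 = m₂) (hkK' : kK ≠ iK ∧ kK ≠ jK) (hk1' : k1 ≠ i1 ∧ k1 ≠ j1)
    (hk2' : k2 ≠ i2 ∧ k2 ≠ j2) (hx : p ix = x) (hy : p iy = y) (hs : p is = s)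
    (hL : ∀ e ∈ L, p e.1 ≠ p e.2) (hnd : (L.map (pedge p)).Nodup)
    (hLm : ∀ e ∈ L, (p e.1 ≠ mK ∧ p e.2 ≠ mK) ∧ (p e.1 ≠ m₁ ∧ p e.2 ≠ m₁) ∧ (p e.1 ≠ m₂ ∧ p e.2 ≠ m₂))
    (hdK : Disjoint (plainSet p L) EK) (hd1 : Disjoint (plainSet p L ∪ EK) E₁) (hd2 : Disjoint (plainSet p L ∪ EK ∪ E₁) E₂)
    (F : ℕ → Pat3 → Pat3 → ℤ) (μ : ℕ) :
    lev2C (plainSet p L ∪ EK ∪ E₁ ∪ E₂) (CK ∪ C₁ ∪ C₂) x y s F μ =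
      tripleSumC EK CK E₁ C₁ E₂ C₂ uK vK mK u₁ v₁ m₁ u₂ v₂ m₂
        (shape3X L iK jK kK i1 j1 k1 i2 j2 k2 ix iy is F (μ + L.length + 4 * Fintype.card V)) := by
  -- marks are off the terminals (injective names)
  have hmuK : mK ≠ uK := by rw [← hkK, ← hiK]; exact fun h => hkK'.1 (hinj h)
  have hmvK : mK ≠ vK := by rw [← hkK, ← hjK]; exact fun h => hkK'.2 (hinj h)
  have hmu1 : m₁ ≠ u₁ := by rw [← hk1, ← hi1]; exact fun h => hk1'.1 (hinj h)
  have hmv1 : m₁ ≠ v₁ := by rw [← hk1, ← hj1]; exact fun h => hk1'.2 (hinj h)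
  have hmu2 : m₂ ≠ u₂ := by rw [← hk2, ← hi2]; exact fun h => hk2'.1 (hinj h)
  have hmv2 : m₂ ≠ v₂ := by rw [← hk2, ← hj2]; exact fun h => hk2'.2 (hinj h)
  -- host supports: everything but piece `b` lies off `V_b` or at its terminals
  have hmHK : mK ∉ ({z | z ∈ VK → z = uK ∨ z = vK} : Set V) := fun h => (h hmK).elim hmuK hmvK
  have hmH1 : m₁ ∉ ({z | z ∈ V₁ → z = u₁ ∨ z = v₁} : Set V) := fun h => (h hm1).elim hmu1 hmv1
  have hmH2 : m₂ ∉ ({z | z ∈ V₂ → z = u₂ ∨ z = v₂} : Set V) := fun h => (h hm2).elim hmu2 hmv2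
  have hSK : ({z | z ∈ VK → z = uK ∨ z = vK} : Set V) ∩ VK ⊆ {uK, vK} := fun z hz => hz.1 hz.2
  have hS1 : ({z | z ∈ V₁ → z = u₁ ∨ z = v₁} : Set V) ∩ V₁ ⊆ {u₁, v₁} := fun z hz => hz.1 hz.2
  have hS2 : ({z | z ∈ V₂ → z = u₂ ∨ z = v₂} : Set V) ∩ V₂ ⊆ {u₂, v₂} := fun z hz => hz.1 hz.2
  -- skeleton edges have their ends among the names of `L`
  have hPL : ∀ e ∈ (↑(plainSet p L) : Set (Sym2 V)), ∀ z ∈ e, ∃ f ∈ L, z = p f.1 ∨ z = p f.2 := by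
    intro e he z hz
    rw [Finset.mem_coe] at he; unfold plainSet at he; rw [List.mem_toFinset, List.mem_map] at he
    obtain ⟨f, hf, rfl⟩ := he
    exact ⟨f, hf, Sym2.mem_iff.1 hz⟩
  have hPLK : ∀ e ∈ (↑(plainSet p L) : Set (Sym2 V)), ∀ z ∈ e, z ∈ ({z | z ∈ VK → z = uK ∨ z = vK} : Set V) := by
    intro e he z hz hzV
    obtain ⟨f, hf, hz'⟩ := hPL e he z hz
    rcases hz' with rfl | rfl
    · rcases hpK f.1 hzV with h | h | h
      · exact Or.inl h
      · exact Or.inr h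
      · exact absurd h (hLm f hf).1.1
    · rcases hpK f.2 hzV with h | h | h
      · exact Or.inl h
      · exact Or.inr h
      · exact absurd h (hLm f hf).1.2
  have hPL1 : ∀ e ∈ (↑(plainSet p L) : Set (Sym2 V)), ∀ z ∈ e, z ∈ ({z | z ∈ V₁ → z = u₁ ∨ z = v₁} : Set V) := by
    intro e he z hz hzV
    obtain ⟨f, hf, hz'⟩ := hPL e he z hz
    rcases hz' with rfl | rfl
    · rcases hp1 f.1 hzV with h | h | h
      · exact Or.inl h
      · exact Or.inr h
      · exact absurd h (hLm f hf).2.1.1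
    · rcases hp1 f.2 hzV with h | h | h
      · exact Or.inl h
      · exact Or.inr h
      · exact absurd h (hLm f hf).2.1.2
  have hPL2 : ∀ e ∈ (↑(plainSet p L) : Set (Sym2 V)), ∀ z ∈ e, z ∈ ({z | z ∈ V₂ → z = u₂ ∨ z = v₂} : Set V) := by
    intro e he z hz hzV
    obtain ⟨f, hf, hz'⟩ := hPL e he z hz
    rcases hz' with rfl | rfl
    · rcases hp2 f.1 hzV with h | h | h
      · exact Or.inl h
      · exact Or.inr h
      · exact absurd h (hLm f hf).2.2.1
    · rcases hp2 f.2 hzV with h | h | h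
      · exact Or.inl h
      · exact Or.inr h
      · exact absurd h (hLm f hf).2.2.2
  have hH1 : ∀ e ∈ (↑(plainSet p L ∪ EK ∪ CK) : Set (Sym2 V)), ∀ z ∈ e, z ∈ ({z | z ∈ V₁ → z = u₁ ∨ z = v₁} : Set V) := by
    intro e he z hz
    rw [Finset.coe_union, Finset.coe_union, Set.union_assoc] at he
    rcases he with he | he
    · exact hPL1 e he z hz
    · rw [← Finset.coe_union] at he
      exact fun hzV => hK1 z (hEK e he z hz) hzV
  have hH2 : ∀ e ∈ (↑(plainSet p L ∪ EK ∪ E₁ ∪ (CK ∪ C₁)) : Set (Sym2 V)), ∀ z ∈ e,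
      z ∈ ({z | z ∈ V₂ → z = u₂ ∨ z = v₂} : Set V) := by
    intro e he z hz hzV
    simp only [Finset.coe_union, Set.mem_union] at he
    rcases he with ((he | he) | he) | (he | he)
    · exact hPL2 e he z hz hzV
    · exact hK2 z (hEK e (by rw [Finset.coe_union]; exact Or.inl he) z hz) hzV
    · exact h12 z (hE1 e (by rw [Finset.coe_union]; exact Or.inl he) z hz) hzV
    · exact hK2 z (hEK e (by rw [Finset.coe_union]; exact Or.inr he) z hz) hzV
    · exact h12 z (hE1 e (by rw [Finset.coe_union]; exact Or.inr he) z hz) hzV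
  -- the summand, kept opaque through the peels
  set g : ℕ → (ι → ι → Bool) → (ι → ι → Bool) → ℤ := fun n A B =>
    (if n = μ + 6 * Fintype.card V + L.length then F 0 (rdPat ix iy is A) (rdPat ix iy is B) else 0) +
      (if n + 1 = μ + 6 * Fintype.card V + L.length then F 1 (rdPat ix iy is A) (rdPat ix iy is B) else 0) with hg
  -- step 0: `lev2C` as a configuration sum read on the matrices
  unfold lev2C
  rw [Finset.sum_congr rfl fun γ _ => show
      ((if apExpC (plainSet p L ∪ EK ∪ E₁ ∪ E₂) (CK ∪ C₁ ∪ C₂) γ = μ then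
          F 0 (pat3 (γ ∪ (CK ∪ C₁ ∪ C₂)) x y s) (pat3 ((plainSet p L ∪ EK ∪ E₁ ∪ E₂) \ γ ∪ (CK ∪ C₁ ∪ C₂)) x y s) else 0) +
        (if apExpC (plainSet p L ∪ EK ∪ E₁ ∪ E₂) (CK ∪ C₁ ∪ C₂) γ + 1 = μ then
          F 1 (pat3 (γ ∪ (CK ∪ C₁ ∪ C₂)) x y s) (pat3 ((plainSet p L ∪ EK ∪ E₁ ∪ E₂) \ γ ∪ (CK ∪ C₁ ∪ C₂)) x y s) else 0)) =
      g (apExpC (plainSet p L ∪ EK ∪ E₁ ∪ E₂) (CK ∪ C₁ ∪ C₂) γ + 2 * Fintype.card V + (4 * Fintype.card V + L.length))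
        (cmat p (γ ∪ (CK ∪ C₁ ∪ C₂))) (cmat p ((plainSet p L ∪ EK ∪ E₁ ∪ E₂) \ γ ∪ (CK ∪ C₁ ∪ C₂))) by
    simp only [hg, rdPat, ← pat3_eq_ofBits_cmat p _ hx hy hs]
    exact lev_pair_congr (by omega) _ _]
  -- step 1: peel piece 2 (host = skeleton ∪ K ∪ 1, contracted `CK ∪ C₁`)
  rw [sum_attachPatCC hd2 hH2 hE2 hS2 huv2 hmH2 hmu2 hmv2 hp2 hi2 hj2 hk2 (4 * Fintype.card V + L.length) g,
    Finset.sum_comm]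
  -- step 2: peel piece 1 inside (host = skeleton ∪ K, contracted `CK`)
  have peel1 := fun (γ₂ : Finset (Sym2 V)) =>
    sum_attachPatCC hd1 hH1 hE1 hS1 huv1 hmH1 hmu1 hmv1 hp1 hi1 hj1 hk1 (2 * Fintype.card V + L.length + apExpC E₂ C₂ γ₂)
      (fun n A B => g (n + (if A i2 j2 && (pat3 (γ₂ ∪ C₂) u₂ v₂ m₂).xy then 1 else 0) +
          (if B i2 j2 && (pat3 (E₂ \ γ₂ ∪ C₂) u₂ v₂ m₂).xy then 1 else 0))
        (attachPat A i2 j2 k2 (pat3 (γ₂ ∪ C₂) u₂ v₂ m₂)) (attachPat B i2 j2 k2 (pat3 (E₂ \ γ₂ ∪ C₂) u₂ v₂ m₂)))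
  rw [Finset.sum_congr rfl fun γ₂ _ => ((Finset.sum_congr rfl fun γ' _ => by congr 1; omega).trans
    ((peel1 γ₂).trans Finset.sum_comm))]
  -- step 3: peel piece K inside (host = skeleton, nothing contracted)
  have peelK := fun (γ₂ γ₁ : Finset (Sym2 V)) =>
    sum_attachPatC hdK hPLK hEK hSK huvK hmHK hmuK hmvK hpK hiK hjK hkK (L.length + apExpC E₂ C₂ γ₂ + apExpC E₁ C₁ γ₁)
      (fun n A B => g (n +
          (if (attachPat A i1 j1 k1 (pat3 (γ₁ ∪ C₁) u₁ v₁ m₁)) i2 j2 && (pat3 (γ₂ ∪ C₂) u₂ v₂ m₂).xy then 1 else 0) +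
          (if (attachPat B i1 j1 k1 (pat3 (E₁ \ γ₁ ∪ C₁) u₁ v₁ m₁)) i2 j2 && (pat3 (E₂ \ γ₂ ∪ C₂) u₂ v₂ m₂).xy then 1 else 0) +
          (if A i1 j1 && (pat3 (γ₁ ∪ C₁) u₁ v₁ m₁).xy then 1 else 0) +
          (if B i1 j1 && (pat3 (E₁ \ γ₁ ∪ C₁) u₁ v₁ m₁).xy then 1 else 0))
        (attachPat (attachPat A i1 j1 k1 (pat3 (γ₁ ∪ C₁) u₁ v₁ m₁)) i2 j2 k2 (pat3 (γ₂ ∪ C₂) u₂ v₂ m₂))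
        (attachPat (attachPat B i1 j1 k1 (pat3 (E₁ \ γ₁ ∪ C₁) u₁ v₁ m₁)) i2 j2 k2 (pat3 (E₂ \ γ₂ ∪ C₂) u₂ v₂ m₂)))
  rw [Finset.sum_congr rfl fun γ₂ _ => Finset.sum_congr rfl fun γ₁ _ =>
    ((Finset.sum_congr rfl fun γ'' _ => by congr 1; omega).trans ((peelK γ₂ γ₁).trans Finset.sum_comm))]
  -- step 4: the skeleton down to the edgeless host
  have peel0 := fun (γ₂ γ₁ γK : Finset (Sym2 V)) =>
    sum_plainList_empty hinj L hL hnd (apExpC E₂ C₂ γ₂ + apExpC E₁ C₁ γ₁ + apExpC EK CK γK)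
      (fun n A B => g (n +
          (if (attachPat (attachPat A iK jK kK (pat3 (γK ∪ CK) uK vK mK)) i1 j1 k1 (pat3 (γ₁ ∪ C₁) u₁ v₁ m₁)) i2 j2 &&
              (pat3 (γ₂ ∪ C₂) u₂ v₂ m₂).xy then 1 else 0) +
          (if (attachPat (attachPat B iK jK kK (pat3 (EK \ γK ∪ CK) uK vK mK)) i1 j1 k1 (pat3 (E₁ \ γ₁ ∪ C₁) u₁ v₁ m₁)) i2 j2 &&
              (pat3 (E₂ \ γ₂ ∪ C₂) u₂ v₂ m₂).xy then 1 else 0) +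
          (if (attachPat A iK jK kK (pat3 (γK ∪ CK) uK vK mK)) i1 j1 && (pat3 (γ₁ ∪ C₁) u₁ v₁ m₁).xy then 1 else 0) +
          (if (attachPat B iK jK kK (pat3 (EK \ γK ∪ CK) uK vK mK)) i1 j1 && (pat3 (E₁ \ γ₁ ∪ C₁) u₁ v₁ m₁).xy then 1 else 0) +
          (if A iK jK && (pat3 (γK ∪ CK) uK vK mK).xy then 1 else 0) +
          (if B iK jK && (pat3 (EK \ γK ∪ CK) uK vK mK).xy then 1 else 0))
        (attachPat (attachPat (attachPat A iK jK kK (pat3 (γK ∪ CK) uK vK mK)) i1 j1 k1 (pat3 (γ₁ ∪ C₁) u₁ v₁ m₁)) i2 j2 k2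
          (pat3 (γ₂ ∪ C₂) u₂ v₂ m₂))
        (attachPat (attachPat (attachPat B iK jK kK (pat3 (EK \ γK ∪ CK) uK vK mK)) i1 j1 k1 (pat3 (E₁ \ γ₁ ∪ C₁) u₁ v₁ m₁))
          i2 j2 k2 (pat3 (E₂ \ γ₂ ∪ C₂) u₂ v₂ m₂)))
  rw [Finset.sum_congr rfl fun γ₂ _ => Finset.sum_congr rfl fun γ₁ _ => Finset.sum_congr rfl fun γK _ =>
    ((Finset.sum_congr rfl fun γ₀ _ => by congr 1; omega).trans (peel0 γ₂ γ₁ γK))]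
  -- step 5: reorder the three configuration sums (`γ₂ γ₁ γK ↦ γK γ₁ γ₂`) and match the summand
  unfold tripleSumC shape3X
  rw [Finset.sum_congr rfl fun γ₂ _ => Finset.sum_comm, Finset.sum_comm]
  refine Finset.sum_congr rfl fun γK _ => ?_
  rw [Finset.sum_comm]
  refine Finset.sum_congr rfl fun γ₁ _ => Finset.sum_congr rfl fun γ₂ _ => ?_
  congr 1
  funext bs
  simp only [hg, side3]
  exact lev_pair_congr (by omega) _ _

/-! ### The symmetrised product cone of a three-piece shape (census g36/g37's machinery, skeleton inside the target) -/

/-- **The coefficient table of a three-piece shape** at residual level `d` (census g39 §4 «coef(D, α)», `t = 3`): the table `F`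
summed over the skeleton colourings whose total correction (plus `F`'s own level) is `d`.  Computable. [folklore] -/
def coefTab3 (L : List (ι × ι)) (iK jK kK i1 j1 k1 i2 j2 k2 ix iy is : ι) (F : ℕ → Pat3 → Pat3 → ℤ) (d : ℕ)
    (PK QK P1 Q1 P2 Q2 : Pat3) : ℤ :=
  sumBits L.length fun bs =>
    (if (side3 L iK jK kK i1 j1 k1 i2 j2 k2 bs PK P1 P2).2 + (side3 L iK jK kK i1 j1 k1 i2 j2 k2 (bs.map (! ·)) QK Q1 Q2).2 = d then
        F 0 (rdPat ix iy is (side3 L iK jK kK i1 j1 k1 i2 j2 k2 bs PK P1 P2).1)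
          (rdPat ix iy is (side3 L iK jK kK i1 j1 k1 i2 j2 k2 (bs.map (! ·)) QK Q1 Q2).1) else 0) +
      (if (side3 L iK jK kK i1 j1 k1 i2 j2 k2 bs PK P1 P2).2 + (side3 L iK jK kK i1 j1 k1 i2 j2 k2 (bs.map (! ·)) QK Q1 Q2).2 + 1 = d
        then F 1 (rdPat ix iy is (side3 L iK jK kK i1 j1 k1 i2 j2 k2 bs PK P1 P2).1)
          (rdPat ix iy is (side3 L iK jK kK i1 j1 k1 i2 j2 k2 (bs.map (! ·)) QK Q1 Q2).1) else 0)

/-- The eightfold flip-symmetrisation of a `d`-indexed coefficient table (term order as g36's `FK.symm8`). [folklore] -/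
def symm8d (coef : ℕ → Pat3 → Pat3 → Pat3 → Pat3 → Pat3 → Pat3 → ℤ) (d : ℕ) (PK QK P1 Q1 P2 Q2 : Pat3) : ℤ :=
  coef d PK QK P1 Q1 P2 Q2 + coef d QK PK P1 Q1 P2 Q2 + (coef d PK QK Q1 P1 P2 Q2 + coef d QK PK Q1 P1 P2 Q2) +
    (coef d PK QK P1 Q1 Q2 P2 + coef d QK PK P1 Q1 Q2 P2 + (coef d PK QK Q1 P1 Q2 P2 + coef d QK PK Q1 P1 Q2 P2))

omit [Fintype V] in
/-- The target-side term at matching levels is the coefficient table. [folklore] -/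
theorem shape3X_eq_coefTab3 (L : List (ι × ι)) (iK jK kK i1 j1 k1 i2 j2 k2 ix iy is : ι) (F : ℕ → Pat3 → Pat3 → ℤ)
    {N eK e1 e2 d : ℕ} (hd : eK + e1 + e2 + d = N) (PK QK P1 Q1 P2 Q2 : Pat3) :
    shape3X L iK jK kK i1 j1 k1 i2 j2 k2 ix iy is F N eK e1 e2 PK QK P1 Q1 P2 Q2 =
      coefTab3 L iK jK kK i1 j1 k1 i2 j2 k2 ix iy is F d PK QK P1 Q1 P2 Q2 := by
  unfold shape3X coefTab3
  congr 1
  funext bs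
  exact lev_pair_congr (by omega) _ _

omit [Fintype V] in
/-- Below the pieces' own levels the target-side term vanishes. [folklore] -/
theorem shape3X_eq_zero (L : List (ι × ι)) (iK jK kK i1 j1 k1 i2 j2 k2 ix iy is : ι) (F : ℕ → Pat3 → Pat3 → ℤ)
    {N eK e1 e2 : ℕ} (h : N < eK + e1 + e2) (PK QK P1 Q1 P2 Q2 : Pat3) :
    shape3X L iK jK kK i1 j1 k1 i2 j2 k2 ix iy is F N eK e1 e2 PK QK P1 Q1 P2 Q2 = 0 := by
  unfold shape3X
  refine sumBits_eq_zero' L.length fun bs => ?_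
  have e1' : ¬ (eK + e1 + e2 + ((side3 L iK jK kK i1 j1 k1 i2 j2 k2 bs PK P1 P2).2 +
      (side3 L iK jK kK i1 j1 k1 i2 j2 k2 (bs.map (! ·)) QK Q1 Q2).2) = N) := by omega
  have e2' : ¬ (eK + e1 + e2 + ((side3 L iK jK kK i1 j1 k1 i2 j2 k2 bs PK P1 P2).2 +
      (side3 L iK jK kK i1 j1 k1 i2 j2 k2 (bs.map (! ·)) QK Q1 Q2).2) + 1 = N) := by omega
  rw [if_neg e1', if_neg e2', add_zero]

omit [Fintype V] in
/-- The corrections of one side number at most `|L| + 3`. [folklore] -/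
theorem side3_snd_le (L : List (ι × ι)) (iK jK kK i1 j1 k1 i2 j2 k2 : ι) (bs : List Bool) (PK P1 P2 : Pat3) :
    (side3 L iK jK kK i1 j1 k1 i2 j2 k2 bs PK P1 P2).2 ≤ L.length + 3 := by
  unfold side3
  have h := (foldBits_snd_le (idMat ι) (zipBits L bs)).trans (length_zipBits_le L bs)
  split_ifs <;> simp only <;> omega

omit [Fintype V] in
/-- The coefficient table vanishes above the structural bound `2|L| + 7`. [folklore] -/
theorem coefTab3_eq_zero (L : List (ι × ι)) (iK jK kK i1 j1 k1 i2 j2 k2 ix iy is : ι) (F : ℕ → Pat3 → Pat3 → ℤ) {d : ℕ}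
    (hd : 2 * L.length + 7 < d) (PK QK P1 Q1 P2 Q2 : Pat3) :
    coefTab3 L iK jK kK i1 j1 k1 i2 j2 k2 ix iy is F d PK QK P1 Q1 P2 Q2 = 0 := by
  unfold coefTab3
  refine sumBits_eq_zero' L.length fun bs => ?_
  have h1 := side3_snd_le L iK jK kK i1 j1 k1 i2 j2 k2 bs PK P1 P2
  have h2 := side3_snd_le L iK jK kK i1 j1 k1 i2 j2 k2 (bs.map (! ·)) QK Q1 Q2
  have e1' : ¬ ((side3 L iK jK kK i1 j1 k1 i2 j2 k2 bs PK P1 P2).2 +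
      (side3 L iK jK kK i1 j1 k1 i2 j2 k2 (bs.map (! ·)) QK Q1 Q2).2 = d) := by omega
  have e2' : ¬ ((side3 L iK jK kK i1 j1 k1 i2 j2 k2 bs PK P1 P2).2 +
      (side3 L iK jK kK i1 j1 k1 i2 j2 k2 (bs.map (! ·)) QK Q1 Q2).2 + 1 = d) := by omega
  rw [if_neg e1', if_neg e2', add_zero]

/-- **THE PRODUCT-CONE THEOREM FOR THREE-PIECE SHAPES, rowwise form** (census g39 §4 / §11 (iii)–(iv), `t = 3`: the K₄
leaves EEE; in census g37's minors form): rowwise domination `8·Σ λ·tensor ≤ Dn·symm8d (coefTab3 …)` by products of generators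
levelwise nonnegative on the three piece minors gives `F` levelwise nonnegative on the composite minor.  Proof = g37's
`cone3C_level_nonneg_sym` with `FK.lev2C_shape3` as the decomposition and `FK.shape3X` in place of `xterm`.  Front end: the
tabulated/filtered check of the data files (`…Pat3ShapeThreeTab.lean`; the direct `FK.certCheck3S` lives there too).
[cite: AyyerLinussonRavichandran2025, §7 (p. 22)] -/
theorem shape3C_nonneg_of_rows (hinj : Function.Injective p)
    (hEK : ∀ e ∈ (↑(EK ∪ CK) : Set (Sym2 V)), ∀ z ∈ e, z ∈ VK) (hE1 : ∀ e ∈ (↑(E₁ ∪ C₁) : Set (Sym2 V)), ∀ z ∈ e, z ∈ V₁)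
    (hE2 : ∀ e ∈ (↑(E₂ ∪ C₂) : Set (Sym2 V)), ∀ z ∈ e, z ∈ V₂)
    (hpK : ∀ a, p a ∈ VK → p a = uK ∨ p a = vK ∨ p a = mK) (hp1 : ∀ a, p a ∈ V₁ → p a = u₁ ∨ p a = v₁ ∨ p a = m₁)
    (hp2 : ∀ a, p a ∈ V₂ → p a = u₂ ∨ p a = v₂ ∨ p a = m₂)
    (hK1 : ∀ z ∈ VK, z ∈ V₁ → z = u₁ ∨ z = v₁) (hK2 : ∀ z ∈ VK, z ∈ V₂ → z = u₂ ∨ z = v₂) (h12 : ∀ z ∈ V₁, z ∈ V₂ → z = u₂ ∨ z = v₂)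
    (hmK : mK ∈ VK) (hm1 : m₁ ∈ V₁) (hm2 : m₂ ∈ V₂) (huvK : uK ≠ vK) (huv1 : u₁ ≠ v₁) (huv2 : u₂ ≠ v₂)
    (hiK : p iK = uK) (hjK : p jK = vK) (hkK : p kK = mK) (hi1 : p i1 = u₁) (hj1 : p j1 = v₁) (hk1 : p k1 = m₁)
    (hi2 : p i2 = u₂) (hj2 : p j2 = v₂) (hk2 : p k2 = m₂) (hkK' : kK ≠ iK ∧ kK ≠ jK) (hk1' : k1 ≠ i1 ∧ k1 ≠ j1)
    (hk2' : k2 ≠ i2 ∧ k2 ≠ j2) (hx : p ix = x) (hy : p iy = y) (hs : p is = s)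
    (hL : ∀ e ∈ L, p e.1 ≠ p e.2) (hnd : (L.map (pedge p)).Nodup)
    (hLm : ∀ e ∈ L, (p e.1 ≠ mK ∧ p e.2 ≠ mK) ∧ (p e.1 ≠ m₁ ∧ p e.2 ≠ m₁) ∧ (p e.1 ≠ m₂ ∧ p e.2 ≠ m₂))
    (hdK : Disjoint (plainSet p L) EK) (hd1 : Disjoint (plainSet p L ∪ EK) E₁) (hd2 : Disjoint (plainSet p L ∪ EK ∪ E₁) E₂)
    (F : ℕ → Pat3 → Pat3 → ℤ) {prods : List Prod3} {Dn : ℕ} (hDn : 0 < Dn)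
    (hrow : ∀ d PK QK P1 Q1 P2 Q2, 8 * (prods.map fun q => (q.lam : ℤ) * q.tensor d PK QK P1 Q1 P2 Q2).sum ≤
      (Dn : ℤ) * symm8d (coefTab3 L iK jK kK i1 j1 k1 i2 j2 k2 ix iy is F) d PK QK P1 Q1 P2 Q2)
    (hval : ∀ q ∈ prods, ∀ ν : ℕ,
      0 ≤ lev2C EK CK uK vK mK q.gK ν ∧ 0 ≤ lev2C E₁ C₁ u₁ v₁ m₁ q.g1 ν ∧ 0 ≤ lev2C E₂ C₂ u₂ v₂ m₂ q.g2 ν) (μ : ℕ) :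
    0 ≤ lev2C (plainSet p L ∪ EK ∪ E₁ ∪ E₂) (CK ∪ C₁ ∪ C₂) x y s F μ := by
  set N := μ + L.length + 4 * Fintype.card V with hN
  -- Step 1: the decomposition, symmetrised
  have e1 := lev2C_shape3 hinj hEK hE1 hE2 hpK hp1 hp2 hK1 hK2 h12 hmK hm1 hm2 huvK huv1 huv2 hiK hjK hkK hi1 hj1 hk1 hi2 hj2 hk2
    hkK' hk1' hk2' hx hy hs hL hnd hLm hdK hd1 hd2 F μ
  have e8 : 8 * ((Dn : ℤ) * lev2C (plainSet p L ∪ EK ∪ E₁ ∪ E₂) (CK ∪ C₁ ∪ C₂) x y s F μ) =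
      (Dn : ℤ) * tripleSumC EK CK E₁ C₁ E₂ C₂ uK vK mK u₁ v₁ m₁ u₂ v₂ m₂
        (symm8 (shape3X L iK jK kK i1 j1 k1 i2 j2 k2 ix iy is F N)) := by
    rw [e1, ← tripleSumC_symm8]; ring
  -- Step 2: termwise domination by the certificate
  have step2 : ∀ eK e1 e2 PK QK P1 Q1 P2 Q2,
      8 * ∑ j : Fin prods.length, ((prods.get j).lam : ℤ) * bterm (prods.get j) N eK e1 e2 PK QK P1 Q1 P2 Q2 ≤
        (Dn : ℤ) * symm8 (shape3X L iK jK kK i1 j1 k1 i2 j2 k2 ix iy is F N) eK e1 e2 PK QK P1 Q1 P2 Q2 := by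
    intro eK e1 e2 PK QK P1 Q1 P2 Q2
    by_cases hle : eK + e1 + e2 ≤ N
    · obtain ⟨d, hd⟩ := Nat.exists_eq_add_of_le hle
      have hd' : eK + e1 + e2 + d = N := hd.symm
      have hx' : symm8 (shape3X L iK jK kK i1 j1 k1 i2 j2 k2 ix iy is F N) eK e1 e2 PK QK P1 Q1 P2 Q2 =
          symm8d (coefTab3 L iK jK kK i1 j1 k1 i2 j2 k2 ix iy is F) d PK QK P1 Q1 P2 Q2 := by
        simp only [symm8, symm8d, shape3X_eq_coefTab3 L iK jK kK i1 j1 k1 i2 j2 k2 ix iy is F hd']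
      rw [hx', Finset.sum_congr rfl fun j _ => by rw [bterm_eq_tensor (prods.get j) hd'],
        ← list_sum_eq_finset_sum prods (fun q => (q.lam : ℤ) * q.tensor d PK QK P1 Q1 P2 Q2)]
      exact hrow d PK QK P1 Q1 P2 Q2
    · rw [not_le] at hle
      have hx' : symm8 (shape3X L iK jK kK i1 j1 k1 i2 j2 k2 ix iy is F N) eK e1 e2 PK QK P1 Q1 P2 Q2 = 0 := by
        simp only [symm8, shape3X_eq_zero L iK jK kK i1 j1 k1 i2 j2 k2 ix iy is F hle, add_zero]
      rw [hx', mul_zero, Finset.sum_eq_zero fun j _ => by rw [bterm_eq_zero (prods.get j) hle, mul_zero], mul_zero]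
  -- Step 3: assemble (the product side is nonnegative by g37's regrouping)
  have main : 0 ≤ 8 * ((Dn : ℤ) * lev2C (plainSet p L ∪ EK ∪ E₁ ∪ E₂) (CK ∪ C₁ ∪ C₂) x y s F μ) := by
    rw [e8, ← tripleSumC_const_mul]
    refine le_trans ?_ (tripleSumC_mono EK CK E₁ C₁ E₂ C₂ uK vK mK u₁ v₁ m₁ u₂ v₂ m₂ step2)
    rw [tripleSumC_const_mul, tripleSumC_finset_sum]
    refine mul_nonneg (by norm_num) (Finset.sum_nonneg fun j _ => ?_)
    rw [tripleSumC_const_mul]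
    exact mul_nonneg (Nat.cast_nonneg _)
      (tripleSumC_bterm_nonneg EK CK E₁ C₁ E₂ C₂ uK vK mK u₁ v₁ m₁ u₂ v₂ m₂ (prods.get j) N (hval _ (List.get_mem prods j)))
  have hDn' : (0 : ℤ) < Dn := by exact_mod_cast hDn
  nlinarith

end ShapeThree

end FK

end Summit.CriticalPhenomena.PercolationContinuityZ3.Theorems
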